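import Literature.NumberTheory.Rogawski1990.UnitFundamentalLemmaInertFlickerClasses        -- ★ (F0) FILES 1–3
import Literature.NumberTheory.Rogawski1990.UnitFundamentalLemmaInertFlickerScalarsCM      -- ★ (F0) FILE 4
import Literature.NumberTheory.Automorphic.RankTwoEigenframeOfSplitCharpoly                -- ★ (E1) eigenframe from a root at `w`
import Literature.NumberTheory.Automorphic.AnisotropicUnitaryGroupCompactOfPlace           -- ★ `conjLocal_apply_eq_of_smul_eq`, `localGram_apply_apply`
import Literature.NumberTheory.Rogawski1990.ExplicitFactorKappaAlmostEverywhereOne          -- ★ `conjLocal_finGammaTwo_mul_finGammaTwo`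
import HarnessLib

/-!
# Four matched representatives of `G′_v` over Flicker's literals `t₁, t_π, t₃, t₄`: the G-side dictionary of the count junction (F12)
# (Flicker 1998 §2 Prop. 3, §3 p. 80; Rogawski 1990 §3.6, §4.3, §14.2)

Topic `NumberTheory/Rogawski1990`; namespace `Literature.NumberTheory.Rogawski1990`.  **Theorems only** (no `def`, no instance, no notation, no named
fact, no `sorry`); imports = tree.  Brick «(F12)-SIDE PACKAGING» of the road «N7-ns COUNT FROM FLICKER» (LEAD F0P3a-plan T8-71 (b)), for the consumer ★
`finsum_delta_mul_classOrbitalIntegral_eq_of_four_classes_of_values` (p04 (g12), ★ `UnitFundamentalLemmaInertSplitClauseOfValues`), which closes the RHS of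
the line stub `stub_countSplitClause` from: four MATCHED representatives `t₁ … t₄ ∈ G′_v` (`h₁ … h₄`), a type-(1) eigenframe of `t₁` (`hP hu′ hu′1`),
`t₁ ≁ t₂`, `t₃ ≁ t₄` (`h12 h34`), the signs `κ = (+,+,−,−)` and the four orbital-integral values.  THIS FILE supplies `h₁ … h₄, hP, hu′, hu′1, h12, h34` and
identifies the `tᵢ` with FLICKER'S LITERALS through the level-preserving congruence `ψ : G′_v ≃ₜ* U(Φ₃)(L⁺_v)` (so that the values are the congruence-volume
counts of [Flicker1998UnitaryFL, Props. 10–14] at the literals); the signs are the sequel's.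

**Setting.** `L` CM, `v` a finite place of `L⁺` non-split (`w ∣ v`, `c • w = w`) and unramified in `L`, `H′` hermitian of good reduction at `w`;
`E_v = L ⊗ L⁺_v = UnitaryGroup.LocalRing L v` (a field, `σ = conjLocal`), `G′_v = (cmDatum L 3 H′).Local v`, `U(Φ₃)(L⁺_v) = UnitaryGroup.«local» L c 3 Φ₃ v`,
`γ_H = (g, u) ∈ H_v` with `u = finGammaTwo`.  INPUT (the consumer's adapter produces them from the stub binders): a frame `g P₂ = P₂ diag(a, d)` of the
`U(Φ₂)`-part with norm-one `a ≠ d` both `≠ u` (★ `exists_eigenframe_cmDatum_local_of_isRoot_map_of_separable` from a root of `χ_{g,w}`; norm one from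
ellipticity) and Flicker's scalars `e, π, π′, x, y ∈ E_v` (`2e = 1`; `π` a `σ`-fixed non-norm, `π π′ = 1`; `σ(x)x = 2`, `σ(y)y = −2`: ★
`exists_flicker_scalars_of_nonsplit` at `|2|_v = 1`).

**Contents.**
* §1 generic: `isConj_of_mul_frame_eq` (two frames for one diagonal ⇒ conjugate), `conj_mul_frame_eq`, `exists_generalLinearGroup_val_eq_of_unitary`
  (`ᵗσM Φ M = Φ`, `Φ² = 1` ⇒ `M ∈ GL`), `antidiagOne_three_mul_self`, `inv_mul_conj_mul_eq`.
* §2 **`exists_localRing_congr`**: `T̃ ∈ GL₃(E_v)` with `ᵗσ(T̃) Φ₃ T̃ = H′ ⊗ 1` and `ψ : G′_v ≃ₜ* U(Φ₃)(L⁺_v)`, `ψ g = T̃ g T̃⁻¹`, `ψ(K′) = K` (★ integral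
  Jacobowitz at `w` + ★ `localNonsplitCongr`, read back on `E_v` entrywise at the unique place `w`); `adelicForm_antidiagOne_map_adeleToLocal`.
* §3 **`exists_flicker_literals_mem_local`**: the literals `t₁`, `diag(π,1,1) t₁ diag(π,1,1)⁻¹ = t_π(a,b,d)`, `g₃ t₁ g₃⁻¹ = t_π(a,d,b)`, `g₄ t₁ g₄⁻¹ = t_π(b,a,d)`
  (★ `UnitFundamentalLemmaInertFlickerTorus`) as elements of `U(Φ₃)(L⁺_v)`.
* §4 `endoEmbLocal_mul_endoGL_frame` (`ι(γ_H) ι(P₂,1) = ι(P₂,1) diag(a,u,d)`), `isLocalNormPair_symm_of_frames` (matching through `ψ`),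
  `not_isConj_of_normTest` (one passing∕failing norm test separates classes, ★ B-p04 `exists_unitary_conj_iff_forall_exists_norm`), and the package
  **`exists_four_matched_flicker_representatives`**: `∃ T̃ ψ t₁ t₂ t₃ t₄ τ₁ τ₂ τ₃ τ₄ P P₁ d_π g₃ g₄` with the congruence clauses, `IsLocalNormPair γ_H tᵢ`
  (×4), `t₁ P = P diag(a,u,d)`, `u′` injective and norm one, `P = T̃⁻¹ P₁`, `ψ tᵢ = τᵢ`, the literal matrices of `τᵢ` and of the conjugators, and
  `t₁ ≁ t₂` (test `(1,0,1)` at slot `0`), `t₃ ≁ t₄` (tests `(1,1,0)` vs `(0,1,1)` at slot `0`).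

Downstream: the values `classOrbitalIntegral mG 1_{K′} ⟦tᵢ⟧` are read in `U(σ_w,Φ₃)(L_w)` through ★ `exists_frame_of_nonsplit` ∕ `ψ` (`1_{K′} = 1_K ∘ ψ`), and the
signs from the middle-slot tests of ★ `UnitFundamentalLemmaInertFlickerClasses` with ★ `finKappaAt_conj_eq_iff_normTest`.

Elaboration notes: the `E_v`-carrier is a `Π`-type; every statement mentions `UnitaryGroup.«local» …` at most twice, the four representatives are
`ψ.symm τᵢ`, the conjugator identities use the abstract `inv_mul_conj_mul_eq` (never `group` on `GL₃(E_v)` terms), and `π⁻¹` is a binder `π′`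
(`Pi.instInv` ≠ the field inverse syntactically).

## References
* Y. Z. Flicker, *Elementary proof of the fundamental lemma for a unitary group*, Canad. J. Math. 50 (1998) 74–98, §2 Prop. 3 pp. 78–79, §3 p. 80
  [Flicker1998UnitaryFL].
* J. Rogawski, *Automorphic Representations of Unitary Groups in Three Variables*, Ann. of Math. Stud. 123 (1990), §3.1 p. 19, §3.5 Prop. 3.5.2 p. 29,
  §3.6 p. 31, §4.3 (4.3.1) p. 43, §4.8–4.9 pp. 53–55, §14.2 p. 233 [Rogawski1990].
* R. Jacobowitz, *Hermitian forms over local fields*, Amer. J. Math. 84 (1962), §7 [Jacobowitz1962].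
* V. Platonov, A. Rapinchuk, *Algebraic Groups and Number Theory* (1994), §2.3, §5.1 [PlatonovRapinchuk1994].
* C. P. Mok, *Endoscopic classification of representations of quasi-split unitary groups*, Mem. AMS 235 (2015), §1 p. 5 [Mok2014].
-/

set_option autoImplicit false

noncomputable section

open NumberField IsDedekindDomain Matrix
open scoped MatrixGroups

namespace Literature.NumberTheory.Rogawski1990

open Literature.NumberTheory.Automorphic Literature.NumberTheory.Automorphic.UnitaryGroup
open Literature.AlgebraicGeometry.ShimuraVarieties (unitaryGroup)

/-! ## §1 Generic matrix helpers (any commutative ring) -/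

section Generic

variable {R : Type*} [CommRing R] {n : Type*} [Fintype n] [DecidableEq n]

/-- **Two elements with eigenframes for the same diagonal are conjugate**: `X P = P D`, `Y Q = Q D` (`P, Q ∈ GL_n`) ⇒ `Y = (Q P⁻¹) X (Q P⁻¹)⁻¹`.
[cite: Rogawski1990, §3.1 p. 19] -/
theorem isConj_of_mul_frame_eq {X Y P Q : GL n R} {D : Matrix n n R} (hX : X.val * P.val = P.val * D) (hY : Y.val * Q.val = Q.val * D) :
    IsConj X Y := by
  refine isConj_iff.2 ⟨Q * P⁻¹, Units.ext ?_⟩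
  have hPP : (P⁻¹).val * P.val = 1 := by rw [← Units.val_mul, inv_mul_cancel, Units.val_one]
  have hQQ : Q.val * (Q⁻¹).val = 1 := by rw [← Units.val_mul, mul_inv_cancel, Units.val_one]
  have hXD : (P⁻¹).val * X.val * P.val = D := by rw [Matrix.mul_assoc, hX, ← Matrix.mul_assoc, hPP, Matrix.one_mul]
  calc ((Q * P⁻¹) * X * (Q * P⁻¹)⁻¹ : GL n R).val
      = Q.val * ((P⁻¹).val * X.val * P.val) * (Q⁻¹).val := by
        rw [show (Q * P⁻¹)⁻¹ = P * Q⁻¹ by rw [_root_.mul_inv_rev, inv_inv]]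
        simp only [Units.val_mul, Matrix.mul_assoc]
    _ = Y.val := by
        rw [hXD, ← hY, Matrix.mul_assoc, hQQ, Matrix.mul_one]

/-- **Frames move under conjugation**: `t P = P D` ⇒ `(g t g⁻¹)(g P) = (g P) D`. [cite: Rogawski1990, §3.1 p. 19] -/
theorem conj_mul_frame_eq {g t P : GL n R} {D : Matrix n n R} (h : t.val * P.val = P.val * D) :
    (g * t * g⁻¹).val * (g.val * P.val) = (g.val * P.val) * D := by
  have hgg : (g⁻¹).val * g.val = 1 := by rw [← Units.val_mul, inv_mul_cancel, Units.val_one]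
  simp only [Units.val_mul]
  calc g.val * t.val * (g⁻¹).val * (g.val * P.val) = g.val * (t.val * (((g⁻¹).val * g.val) * P.val)) := by
        simp only [Matrix.mul_assoc]
    _ = g.val * P.val * D := by rw [hgg, Matrix.one_mul, h, Matrix.mul_assoc]

/-- **A matrix preserving an involutive Gram matrix is invertible**: `Φ Φ = 1`, `ᵗσ(M) Φ M = Φ` ⇒ some `g ∈ GL_n` has `g.val = M`
(inverse `Φ ᵗσ(M) Φ`). [cite: Rogawski1990, §3.1 p. 19] -/
theorem exists_generalLinearGroup_val_eq_of_unitary (σ : R →+* R) {Φ M : Matrix n n R} (hΦ : Φ * Φ = 1) (hM : (M.map σ)ᵀ * Φ * M = Φ) :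
    ∃ g : GL n R, g.val = M := by
  have hNM : Φ * (M.map σ)ᵀ * Φ * M = 1 := by rw [Matrix.mul_assoc (Φ * (M.map σ)ᵀ), Matrix.mul_assoc Φ, ← Matrix.mul_assoc (M.map σ)ᵀ, hM, hΦ]
  have hMN : M * (Φ * (M.map σ)ᵀ * Φ) = 1 := mul_eq_one_comm.1 hNM
  exact ⟨⟨M, Φ * (M.map σ)ᵀ * Φ, hMN, hNM⟩, rfl⟩

/-- `Φ₃ Φ₃ = 1`. [cite: Mok2014, §1 Notation p. 5] -/
theorem antidiagOne_three_mul_self :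
    (Matrix.of fun i j : Fin 3 => if i.val + j.val + 1 = 3 then (1 : R) else 0) * (Matrix.of fun i j : Fin 3 => if i.val + j.val + 1 = 3 then (1 : R) else 0) = 1 := by
  ext i j
  fin_cases i <;> fin_cases j <;> simp [Matrix.mul_apply, Fin.sum_univ_three, Matrix.of_apply]

/-- Conjugation transport: `T⁻¹ (g t g⁻¹) T = (T⁻¹ g T)(T⁻¹ t T)(T⁻¹ g T)⁻¹` (how the consumer reads `tᵢ = cᵢ t₁ cᵢ⁻¹`, `cᵢ = T̃⁻¹ gᵢ T̃`, from `ψ tᵢ = gᵢ (ψ t₁) gᵢ⁻¹`).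
[cite: Rogawski1990, §3.1 p. 19] -/
theorem inv_mul_conj_mul_eq {G : Type*} [Group G] (T g t : G) :
    T⁻¹ * (g * t * g⁻¹) * T = (T⁻¹ * g * T) * (T⁻¹ * t * T) * (T⁻¹ * g * T)⁻¹ := by
  group

end Generic

/-! ## §2 The level-preserving congruence `ψ : G′_v ≃ₜ* U(Φ₃)(L⁺_v)` on the `LocalRing` carrier: `ψ g = T̃ g T̃⁻¹`, `ᵗσ(T̃) Φ₃ T̃ = H′_v` -/

section Congr

variable (L : Type) [Field L] [NumberField L] [IsCMField L] (H' : Matrix (Fin 3) (Fin 3) L)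
  {v : HeightOneSpectrum (𝓞 ↥(maximalRealSubfield L))}

omit [IsCMField L] in
/-- The localised split form IS the literal `Φ₃` over `E_v = L ⊗ L⁺_v` (entries `0, 1`, ★ `antidiagOne_map`). [cite: Mok2014, §1 Notation p. 5] -/
theorem adelicForm_antidiagOne_map_adeleToLocal :
    (adelicForm L 3 (Matrix.of fun i j : Fin 3 => if i.val + j.val + 1 = 3 then (1 : L) else 0)).map (adeleToLocal L v) =
      Matrix.of fun i j : Fin 3 => if i.val + j.val + 1 = 3 then (1 : LocalRing L v) else 0 := by
  rw [adelicForm, Matrix.map_map, ← RingHom.coe_comp, antidiagOne_map]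

/-- **THE CONGRUENCE ON THE `LocalRing` CARRIER.**  At a good non-split place: an element `T̃ ∈ GL₃(E_v)` with `ᵗσ(T̃) Φ₃ T̃ = H′ ⊗ 1` and an isomorphism of
topological groups `ψ : G′_v = U(H′)(L⁺_v) ≃ₜ* U(Φ₃)(L⁺_v)`, `ψ g = T̃ g T̃⁻¹`, `ψ⁻¹ g = T̃⁻¹ g T̃`, carrying `K′ = U(H′)(𝒪_v)` onto `K = U(Φ₃)(𝒪_v)`
(★ integral Jacobowitz at `w` + ★ `localNonsplitCongr`, read back on `E_v` through `E_v = L_w`). [cite: Rogawski1990, §14.2 p. 233] [cite: Jacobowitz1962, §7 Thm. 7.1]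
[cite: PlatonovRapinchuk1994, §2.3, §5.1] -/
theorem exists_localRing_congr (hH' : (H'.map (IsCMField.complexConj L))ᵀ = H')
    (w : PlacesOver L v) (hw : IsCMField.complexConj L • w.1 = w.1) (hv : Algebra.IsUnramifiedIn (𝓞 L) v.asIdeal)
    (hH'w : IsUnit (placeForm H' w.1)) (hH'i : hH'w.unit ∈ glInt 3 (w.1.adicCompletion L)) :
    ∃ (Tl : GL (Fin 3) (LocalRing L v))
      (ψ : ↥(UnitaryGroup.«local» L (IsCMField.complexConj L) 3 H' v) ≃ₜ*
        ↥(UnitaryGroup.«local» L (IsCMField.complexConj L) 3 (Matrix.of fun i j : Fin 3 => if i.val + j.val + 1 = 3 then (1 : L) else 0) v)),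
      formCongr (conjLocal L (IsCMField.complexConj L) v) Tl (Matrix.of fun i j : Fin 3 => if i.val + j.val + 1 = 3 then (1 : LocalRing L v) else 0) =
          (adelicForm L 3 H').map (adeleToLocal L v) ∧
      (∀ g, (ψ g).val = Tl * g.val * Tl⁻¹) ∧ (∀ g, (ψ.symm g).val = Tl⁻¹ * g.val * Tl) ∧
      (∀ g, g ∈ cmLocalIntegralLevel L 3 H' v ↔
        ψ g ∈ cmLocalIntegralLevel L 3 (Matrix.of fun i j : Fin 3 => if i.val + j.val + 1 = 3 then (1 : L) else 0) v) := by
  have hc := IsCMField.complexConj_ne_one L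
  haveI : Algebra.IsQuadraticExtension ↥(maximalRealSubfield L) L := IsCMField.isQuadraticExtension L
  haveI : Subsingleton (PlacesOver L v) := PlacesOver.subsingleton_of_smul_eq (IsCMField.complexConj L) hc w hw
  obtain ⟨T, hT, hJT⟩ := exists_glInt_placeForm_eq_formCongr_antidiagonal_of_isUnramifiedIn ↥(maximalRealSubfield L) L
    (IsCMField.complexConj L) hc 3 H' hH' v w hw hv hH'w hH'i
  have h : formCongr (galAdicCompletionMap (L := L) (IsCMField.complexConj L) hw) T
      (placeForm (Matrix.of fun i j : Fin 3 => if i.val + j.val + 1 = 3 then (1 : L) else 0) w.1) =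
        (1 : w.1.adicCompletion L) • placeForm H' w.1 := by
    rw [one_smul, placeForm_antidiagOne, ← hJT]
  set ψ := localNonsplitCongr (IsCMField.complexConj L) hc w hw T isUnit_one h with hψ
  -- the `LocalRing` lift of `T`
  set E := (localGLPiEquiv L 3 v).toMulEquiv.trans (localGLPiEvalEquiv (IsCMField.complexConj L) 3 hc w hw).toMulEquiv with hE
  have hEapply : ∀ x : GL (Fin 3) (LocalRing L v), E x = localGLPiEquiv L 3 v x w := fun x => rfl
  have hEentry : ∀ (x : GL (Fin 3) (LocalRing L v)) (i j : Fin 3), (E x).val i j = x.val i j w := fun x i j => rfl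
  set Tl := E.symm T with hTl
  have hETl : E Tl = T := E.apply_symm_apply T
  -- `ψ` is conjugation by `Tl`
  have hψval : ∀ g, (ψ g).val = Tl * g.val * Tl⁻¹ := by
    intro g
    apply E.injective
    rw [map_mul, map_mul, map_inv, hETl]
    exact localNonsplitEquiv_localNonsplitCongr (IsCMField.complexConj L) hc w hw T isUnit_one h g
  have hψsymm : ∀ g, (ψ.symm g).val = Tl⁻¹ * g.val * Tl := by
    intro g
    have h1 := hψval (ψ.symm g)
    rw [ContinuousMulEquiv.apply_symm_apply] at h1
    rw [h1]; group
  refine ⟨Tl, ψ, ?_, hψval, hψsymm, fun g => ?_⟩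
  · -- the form relation, read entrywise at the unique place `w`
    refine Matrix.ext fun i j => funext fun w' => ?_
    rw [show w' = w from Subsingleton.elim w' w]
    have hΦw : ∀ p q : Fin 3, (Matrix.of fun i j : Fin 3 => if i.val + j.val + 1 = 3 then (1 : LocalRing L v) else 0) p q w =
        placeForm (Matrix.of fun i j : Fin 3 => if i.val + j.val + 1 = 3 then (1 : L) else 0) w.1 p q := fun p q => by
      rw [← adelicForm_antidiagOne_map_adeleToLocal L, localGram_apply_apply 3 _ v w p q]
    have hL : (formCongr (conjLocal L (IsCMField.complexConj L) v) Tl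
        (Matrix.of fun i j : Fin 3 => if i.val + j.val + 1 = 3 then (1 : LocalRing L v) else 0)) i j w =
        (formCongr (galAdicCompletionMap (L := L) (IsCMField.complexConj L) hw) T
          (placeForm (Matrix.of fun i j : Fin 3 => if i.val + j.val + 1 = 3 then (1 : L) else 0) w.1)) i j := by
      simp only [formCongr, Matrix.mul_apply, Matrix.transpose_apply, Matrix.map_apply, Finset.sum_apply, Pi.mul_apply,
        conjLocal_apply_eq_of_smul_eq (IsCMField.complexConj L) hc v w hw, ← hEentry, hETl, hΦw]
    rw [hL, h, one_smul]
    exact (localGram_apply_apply 3 H' v w i j).symm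
  · refine (mem_cmLocalIntegralLevel_iff_conj_mem_glInt L H' w hw hT g).trans ?_
    rw [← localNonsplitEquiv_localNonsplitCongr (IsCMField.complexConj L) hc w hw T isUnit_one h g]
    exact (mem_localIntegralLevel_iff_of_smul_eq (IsCMField.complexConj L) 3 _ hc w hw (ψ g)).symm

end Congr

/-! ## §3 Flicker's four literals as elements of `U(Φ₃)(L⁺_v) ≤ GL₃(E_v)` -/

section Literals

variable (L : Type) [Field L] [NumberField L] [IsCMField L] {v : HeightOneSpectrum (𝓞 ↥(maximalRealSubfield L))}

/-- `(g t g⁻¹).val = M` from `g.val · t.val = M · g.val` in `GL_n`. [folklore] -/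
private theorem val_conj_eq_of_mul_eq' {n : Type*} [Fintype n] [DecidableEq n] {R : Type*} [CommRing R] {g t : GL n R} {M : Matrix n n R}
    (h : g.val * t.val = M * g.val) : (g * t * g⁻¹).val = M := by
  rw [Units.val_mul, Units.val_mul, h, Matrix.mul_assoc, ← Units.val_mul, mul_inv_cancel, Units.val_one, Matrix.mul_one]

/-- **THE FOUR LITERALS IN `U(Φ₃)(L⁺_v)`.**  On `E_v = L ⊗ L⁺_v` at a non-split place (a field), for `e` with `2e = 1`, a `σ`-fixed unit `π`, and norm-one
`a, b, d` (and `π π′ = 1`): Flicker's `t₁ = t_1(a,b,d)` and its conjugates by `diag(π,1,1)`, `g₃`, `g₄` (★ `UnitFundamentalLemmaInertFlickerTorus`) are elements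
`τ₁, τ_π, τ₃, τ₄` of `U(Φ₃)(L⁺_v) = UnitaryGroup.«local» L c 3 Φ₃ v`, with `P₁ = (1 0 1; 0 1 0; −1 0 1) ∈ GL₃(E_v)`.
[cite: Flicker1998UnitaryFL, §2 Prop. 3 pp. 78–79] [cite: Rogawski1990, §3.6 p. 31] -/
theorem exists_flicker_literals_mem_local (w : PlacesOver L v) (hw : IsCMField.complexConj L • w.1 = w.1)
    {e π π' a b d : LocalRing L v} (h2 : 2 * e = 1) (hσπ : conjLocal L (IsCMField.complexConj L) v π = π) (hππ : π * π' = 1)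
    (ha : conjLocal L (IsCMField.complexConj L) v a * a = 1) (hb : conjLocal L (IsCMField.complexConj L) v b * b = 1)
    (hd : conjLocal L (IsCMField.complexConj L) v d * d = 1) :
    ∃ (τ₁ τπ τ₃ τ₄ : ↥(UnitaryGroup.«local» L (IsCMField.complexConj L) 3 (Matrix.of fun i j : Fin 3 => if i.val + j.val + 1 = 3 then (1 : L) else 0) v))
      (P₁ dπ g₃ g₄ : GL (Fin 3) (LocalRing L v)),
      τ₁.val.val = !![e * (a + d), 0, -(e * (a - d)); 0, b, 0; -(e * (a - d)), 0, e * (a + d)] ∧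
      τπ.val = dπ * τ₁.val * dπ⁻¹ ∧ τ₃.val = g₃ * τ₁.val * g₃⁻¹ ∧ τ₄.val = g₄ * τ₁.val * g₄⁻¹ ∧
      P₁.val = !![1, 0, 1; 0, 1, 0; -1, 0, 1] ∧ dπ.val = !![π, 0, 0; 0, 1, 0; 0, 0, 1] ∧
      g₃.val = !![e * π, π, -(e * π); e, 0, e; -e, 1, e] ∧ g₄.val = !![e * π, π, e * π; e, 0, -e; e, -1, e] ∧
      τπ.val.val = !![e * (a + d), 0, -(e * (a - d) * π); 0, b, 0; -(e * (a - d) * π'), 0, e * (a + d)] ∧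
      τ₃.val.val = !![e * (a + b), 0, -(e * (a - b) * π); 0, d, 0; -(e * (a - b) * π'), 0, e * (a + b)] ∧
      τ₄.val.val = !![e * (b + d), 0, -(e * (b - d) * π); 0, a, 0; -(e * (b - d) * π'), 0, e * (b + d)] := by
  obtain ⟨α, hα0, hcα, -⟩ := cmQuadraticGenerator_spec L
  letI : Field (LocalRing L v) :=
    (Liu2021.LemD1IndexedNonVacuityNonsplitPlace.isField_localRing_of_nonsplit L v (IsCMField.complexConj L) hcα hα0 w hw).toField
  set σ := conjLocal L (IsCMField.complexConj L) v with hσ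
  -- scalars
  have h20 : (2 : LocalRing L v) ≠ 0 := fun h0 => by
    have h1 := h2; rw [h0, zero_mul] at h1; exact zero_ne_one h1
  have he2 : e * 2 = 1 := by rw [mul_comm]; exact h2
  have hσe : σ e = e := by
    have h1 : σ e * 2 = 1 := by
      have := congrArg σ he2
      rwa [map_mul, map_ofNat, map_one] at this
    calc σ e = σ e * (2 * e) := by rw [h2, mul_one]
      _ = e := by rw [← mul_assoc, h1, one_mul]
  have hπ0 : π ≠ 0 := fun h0 => by rw [h0, zero_mul] at hππ; exact zero_ne_one hππ
  have hσπ' : σ π' = π' := by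
    have h1 : σ π' * π = 1 := by
      have := congrArg σ hππ
      rwa [map_mul, map_one, hσπ, mul_comm] at this
    calc σ π' = σ π' * (π * π') := by rw [hππ, mul_one]
      _ = π' := by rw [← mul_assoc, h1, one_mul]
  -- the localised form is the literal `Φ₃`
  have hΦ := adelicForm_antidiagOne_map_adeleToLocal L (v := v)
  have hΦΦ := antidiagOne_three_mul_self (R := LocalRing L v)
  -- unitarity of the four literals (★ FILE 2)
  have hu₁ := flickerTorusElt_one_unitary σ (a := a) (b := b) (c := d) h2 hσe ha hb hd
  have huπ := flickerTorusElt_unitary σ (a := a) (b := b) (c := d) h2 hππ hσe hσπ hσπ' ha hb hd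
  have hu₃ := flickerTorusElt_unitary σ (a := a) (b := d) (c := b) h2 hππ hσe hσπ hσπ' ha hd hb
  have hu₄ := flickerTorusElt_unitary σ (a := b) (b := a) (c := d) h2 hππ hσe hσπ hσπ' hb ha hd
  -- GL lifts
  obtain ⟨t₁, ht₁⟩ := exists_generalLinearGroup_val_eq_of_unitary σ hΦΦ hu₁
  have hdP₁ : Matrix.det !![(1 : LocalRing L v), 0, 1; 0, 1, 0; -1, 0, 1] ≠ 0 := by
    rw [show !![(1 : LocalRing L v), 0, 1; 0, 1, 0; -1, 0, 1] = !![(1 : LocalRing L v), 0, 1; 0, 1, 0; -1, 0, 1] from rfl, det_flickerFrame]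
    rw [mul_one]; exact h20
  have hddπ : Matrix.det !![π, 0, 0; 0, 1, 0; 0, 0, (1 : LocalRing L v)] ≠ 0 := by
    simp [Matrix.det_fin_three]; exact hπ0
  have hdg₃ : Matrix.det !![e * π, π, -(e * π); e, 0, e; -e, 1, e] ≠ 0 := by rw [det_gThree h2]; exact neg_ne_zero.2 hπ0
  have hdg₄ : Matrix.det !![e * π, π, e * π; e, 0, -e; e, -1, e] ≠ 0 := by rw [det_gFour h2]; exact neg_ne_zero.2 hπ0
  set P₁ := Matrix.GeneralLinearGroup.mkOfDetNeZero _ hdP₁ with hP₁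
  set dπ := Matrix.GeneralLinearGroup.mkOfDetNeZero _ hddπ with hdπ
  set g₃ := Matrix.GeneralLinearGroup.mkOfDetNeZero _ hdg₃ with hg₃
  set g₄ := Matrix.GeneralLinearGroup.mkOfDetNeZero _ hdg₄ with hg₄
  have hP₁v : P₁.val = !![1, 0, 1; 0, 1, 0; -1, 0, 1] := rfl
  have hdπv : dπ.val = !![π, 0, 0; 0, 1, 0; 0, 0, 1] := rfl
  have hg₃v : g₃.val = !![e * π, π, -(e * π); e, 0, e; -e, 1, e] := rfl
  have hg₄v : g₄.val = !![e * π, π, e * π; e, 0, -e; e, -1, e] := rfl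
  -- the conjugates' matrices (★ FILE 2 conjugation identities)
  have hvπ : (dπ * t₁ * dπ⁻¹).val = !![e * (a + d), 0, -(e * (a - d) * π); 0, b, 0; -(e * (a - d) * π'), 0, e * (a + d)] :=
    val_conj_eq_of_mul_eq' (by rw [hdπv, ht₁]; exact diag_mul_flickerTorusElt_one (e := e) (a := a) (b := b) (c := d) hππ)
  have hv₃ : (g₃ * t₁ * g₃⁻¹).val = !![e * (a + b), 0, -(e * (a - b) * π); 0, d, 0; -(e * (a - b) * π'), 0, e * (a + b)] :=
    val_conj_eq_of_mul_eq' (by rw [hg₃v, ht₁]; exact gThree_mul_flickerTorusElt_one (a := a) (b := b) (c := d) h2 hππ)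
  have hv₄ : (g₄ * t₁ * g₄⁻¹).val = !![e * (b + d), 0, -(e * (b - d) * π); 0, a, 0; -(e * (b - d) * π'), 0, e * (b + d)] :=
    val_conj_eq_of_mul_eq' (by rw [hg₄v, ht₁]; exact gFour_mul_flickerTorusElt_one (a := a) (b := b) (c := d) h2 hππ)
  -- memberships in `U(Φ₃)(L⁺_v)`
  have hmem : ∀ {g : GL (Fin 3) (LocalRing L v)} {M : Matrix (Fin 3) (Fin 3) (LocalRing L v)}, g.val = M →
      (M.map σ)ᵀ * (Matrix.of fun i j : Fin 3 => if i.val + j.val + 1 = 3 then (1 : LocalRing L v) else 0) * M =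
        (Matrix.of fun i j : Fin 3 => if i.val + j.val + 1 = 3 then (1 : LocalRing L v) else 0) →
      g ∈ UnitaryGroup.«local» L (IsCMField.complexConj L) 3 (Matrix.of fun i j : Fin 3 => if i.val + j.val + 1 = 3 then (1 : L) else 0) v := by
    intro g M hg hM
    show g ∈ unitaryGroupOfForm σ _
    rw [mem_unitaryGroupOfForm_iff, hΦ, hg]
    exact hM
  refine ⟨⟨t₁, hmem ht₁ hu₁⟩, ⟨dπ * t₁ * dπ⁻¹, hmem hvπ huπ⟩, ⟨g₃ * t₁ * g₃⁻¹, hmem hv₃ hu₃⟩, ⟨g₄ * t₁ * g₄⁻¹, hmem hv₄ hu₄⟩,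
    P₁, dπ, g₃, g₄, ht₁, rfl, rfl, rfl, hP₁v, hdπv, hg₃v, hg₄v, hvπ, hv₃, hv₄⟩

end Literals

/-! ## §4 THE FOUR MATCHED REPRESENTATIVES OF `G′_v` -/

section Representatives

variable (L : Type) [Field L] [NumberField L] [IsCMField L] (H' : Matrix (Fin 3) (Fin 3) L)
  {v : HeightOneSpectrum (𝓞 ↥(maximalRealSubfield L))}

/-- `![a, b, d]` is injective for pairwise distinct `a, b, d`. [folklore] -/
private theorem injective_vecThree' {α : Type*} {a b d : α} (hab : a ≠ b) (hbd : b ≠ d) (had : a ≠ d) : Function.Injective ![a, b, d] := by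
  intro i j hij
  fin_cases i <;> fin_cases j
  all_goals first | rfl | (exfalso; revert hij; simp [hab, hbd, had, hab.symm, hbd.symm, had.symm])

/-- **The eigenframe of `ι_v(γ_H)`** from a frame of the `U(Φ₂)`-part: `g P₂ = P₂ diag(a, d)` ⇒ `ι(γ_H) · ι(P₂, 1) = ι(P₂, 1) · diag(a, u, d)`, `u = finGammaTwo`
(the pattern `(a 0 0; 0 u 0; 0 0 d) = ι(diag(a,d), u)`, ★ `coe_endoGL_eq`). [cite: Rogawski1990, §4.8 Case (a) p. 53; §4.9 p. 55] -/
theorem endoEmbLocal_mul_endoGL_frame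
    {γH : (cmDatum L 2 (Matrix.of fun i j : Fin 2 => if i.val + j.val + 1 = 2 then (1 : L) else 0)).Local v ×
      (cmDatum L 1 (Matrix.of fun i j : Fin 1 => if i.val + j.val + 1 = 1 then (1 : L) else 0)).Local v}
    {a d : LocalRing L v} {P₂ Da : GL (Fin 2) (LocalRing L v)} (hDa : Da.val = diagonal ![a, d])
    (hP₂ : (γH.1.val.val : Matrix (Fin 2) (Fin 2) (LocalRing L v)) * P₂.val = P₂.val * diagonal ![a, d]) :
    ((endoEmbLocal L v γH).val : GL (Fin 3) (LocalRing L v)).val * (endoGL (P₂, (1 : GL (Fin 1) (LocalRing L v)))).val =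
      (endoGL (P₂, (1 : GL (Fin 1) (LocalRing L v)))).val * diagonal ![a, finGammaTwo L v γH, d] := by
  have hγP : γH.1.val * P₂ = P₂ * Da := Units.ext (by rw [Units.val_mul, Units.val_mul, hDa]; exact hP₂)
  have hXP : ((endoEmbLocal L v γH).val : GL (Fin 3) (LocalRing L v)) * endoGL (P₂, 1) = endoGL (P₂, 1) * endoGL (Da, γH.2.val) := by
    rw [coe_endoEmbLocal, ← map_mul, ← map_mul, Prod.mk_mul_mk, Prod.mk_mul_mk, hγP, mul_one, one_mul]
  have hD : (endoGL (Da, γH.2.val)).val = diagonal ![a, finGammaTwo L v γH, d] := by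
    rw [coe_endoGL_eq, hDa, ← etaDiag_eq_diagonal]
    ext i j
    fin_cases i <;> fin_cases j <;> rfl
  rw [← hD, ← Units.val_mul, hXP, Units.val_mul]

/-- **MATCHING THROUGH THE CONGRUENCE**: if `ψ⁻¹ g = T̃⁻¹ g T̃`, `ι(γ_H)` and `τ₁` have eigenframes for the same diagonal, and `τ = g τ₁ g⁻¹`, then `ι_v(γ_H) ↔ ψ⁻¹ τ`
(★ `IsLocalNormPair` = conjugacy in `GL₃(E_v)`). [cite: Rogawski1990, §3.1 p. 19; §4.3 (4.3.1) p. 43] -/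
theorem isLocalNormPair_symm_of_frames
    {γH : (cmDatum L 2 (Matrix.of fun i j : Fin 2 => if i.val + j.val + 1 = 2 then (1 : L) else 0)).Local v ×
      (cmDatum L 1 (Matrix.of fun i j : Fin 1 => if i.val + j.val + 1 = 1 then (1 : L) else 0)).Local v}
    {Tl PX P₁ g : GL (Fin 3) (LocalRing L v)} {D : Matrix (Fin 3) (Fin 3) (LocalRing L v)}
    (ψ : ↥(UnitaryGroup.«local» L (IsCMField.complexConj L) 3 H' v) ≃ₜ*
      ↥(UnitaryGroup.«local» L (IsCMField.complexConj L) 3 (Matrix.of fun i j : Fin 3 => if i.val + j.val + 1 = 3 then (1 : L) else 0) v))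
    (hψs : ∀ g, (ψ.symm g).val = Tl⁻¹ * g.val * Tl)
    (hX : ((endoEmbLocal L v γH).val : GL (Fin 3) (LocalRing L v)).val * PX.val = PX.val * D)
    {τ₁ τ : ↥(UnitaryGroup.«local» L (IsCMField.complexConj L) 3 (Matrix.of fun i j : Fin 3 => if i.val + j.val + 1 = 3 then (1 : L) else 0) v)}
    (hτ₁ : τ₁.val.val * P₁.val = P₁.val * D) (hτ : τ.val = g * τ₁.val * g⁻¹) :
    IsLocalNormPair L H' v γH (ψ.symm τ) := by
  show IsConj ((endoEmbLocal L v γH).val : GL (Fin 3) (LocalRing L v)) (ψ.symm τ).val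
  rw [hψs τ, hτ]
  refine (isConj_of_mul_frame_eq hX hτ₁).trans (isConj_iff.2 ⟨Tl⁻¹ * g, ?_⟩)
  group

/-- **NON-CONJUGACY FROM ONE NORM TEST** (in `U(Φ₃)(L⁺_v)`): if `τ = g τ₁ g⁻¹`, `τ′ = g′ τ₁ g′⁻¹` with `τ₁` of type (1) (frame `P₁`, norm-one distinct
eigenvalues) and at some slot `i` the test «`⟨g pᵢ, g pᵢ⟩ ∈ N·⟨pᵢ, pᵢ⟩`» PASSES for `g` and FAILS for `g′`, then `τ ≁ τ′` (★ B-p04's criterion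
`exists_unitary_conj_iff_forall_exists_norm`; norms form a group). [cite: Rogawski1990, §3.5 Prop. 3.5.2 (a)(c) p. 29; §3.6 p. 31] -/
theorem not_isConj_of_normTest (w : PlacesOver L v) (hw : IsCMField.complexConj L • w.1 = w.1)
    {a b d : LocalRing L v} (ha1 : conjLocal L (IsCMField.complexConj L) v a * a = 1) (hb1 : conjLocal L (IsCMField.complexConj L) v b * b = 1)
    (hd1 : conjLocal L (IsCMField.complexConj L) v d * d = 1) (hab : a ≠ b) (hbd : b ≠ d) (had : a ≠ d)
    {τ₁ τ τ' : ↥(UnitaryGroup.«local» L (IsCMField.complexConj L) 3 (Matrix.of fun i j : Fin 3 => if i.val + j.val + 1 = 3 then (1 : L) else 0) v)}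
    {P₁ g g' : GL (Fin 3) (LocalRing L v)} (hP : τ₁.val.val * P₁.val = P₁.val * diagonal ![a, b, d])
    (hτ : τ.val = g * τ₁.val * g⁻¹) (hτ' : τ'.val = g' * τ₁.val * g'⁻¹) (i : Fin 3)
    (hgi : ∃ z : LocalRing L v, IsUnit z ∧
      twistGram (conjLocal L (IsCMField.complexConj L) v) (Matrix.of fun i j : Fin 3 => if i.val + j.val + 1 = 3 then (1 : LocalRing L v) else 0)
          (g.val * P₁.val) i i =
        conjLocal L (IsCMField.complexConj L) v z * z *
          twistGram (conjLocal L (IsCMField.complexConj L) v) (Matrix.of fun i j : Fin 3 => if i.val + j.val + 1 = 3 then (1 : LocalRing L v) else 0)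
            P₁.val i i)
    (hg'i : ¬ ∃ z : LocalRing L v, IsUnit z ∧
      twistGram (conjLocal L (IsCMField.complexConj L) v) (Matrix.of fun i j : Fin 3 => if i.val + j.val + 1 = 3 then (1 : LocalRing L v) else 0)
          (g'.val * P₁.val) i i =
        conjLocal L (IsCMField.complexConj L) v z * z *
          twistGram (conjLocal L (IsCMField.complexConj L) v) (Matrix.of fun i j : Fin 3 => if i.val + j.val + 1 = 3 then (1 : LocalRing L v) else 0)
            P₁.val i i) :
    ¬ IsConj τ τ' := by
  classical
  obtain ⟨αg, hα0, hcα, -⟩ := cmQuadraticGenerator_spec L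
  letI : Field (LocalRing L v) :=
    (Liu2021.LemD1IndexedNonVacuityNonsplitPlace.isField_localRing_of_nonsplit L v (IsCMField.complexConj L) hcα hα0 w hw).toField
  intro hc
  obtain ⟨c, hc⟩ := isConj_iff.1 hc
  have hcval : c.val * τ.val * c.val⁻¹ = τ'.val := by
    have := congrArg Subtype.val hc
    simpa only [Subgroup.coe_mul, Subgroup.coe_inv] using this
  -- memberships in `unitaryGroup σ Φ₃` (★ B-p04's carrier; same membership condition)
  have hΦ := adelicForm_antidiagOne_map_adeleToLocal L (v := v)
  have hmem : ∀ x : ↥(UnitaryGroup.«local» L (IsCMField.complexConj L) 3 (Matrix.of fun i j : Fin 3 => if i.val + j.val + 1 = 3 then (1 : L) else 0) v),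
      x.val ∈ unitaryGroup (conjLocal L (IsCMField.complexConj L) v)
        (Matrix.of fun i j : Fin 3 => if i.val + j.val + 1 = 3 then (1 : LocalRing L v) else 0) := by
    intro x
    have hx := x.2
    change x.val ∈ unitaryGroupOfForm _ _ at hx
    rw [mem_unitaryGroupOfForm_iff, hΦ] at hx
    exact Literature.AlgebraicGeometry.ShimuraVarieties.mem_unitaryGroup_iff.2 hx
  have hγ := hmem τ₁
  have hg := hmem τ
  have hg' := hmem τ'
  rw [hτ] at hg hcval
  rw [hτ'] at hg' hcval
  have hHd : (Matrix.of fun i j : Fin 3 => if i.val + j.val + 1 = 3 then (1 : LocalRing L v) else 0).det ≠ 0 :=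
    (isUnit_det_antidiagOne_three (R := LocalRing L v)).ne_zero
  have hu1 : ∀ i, conjLocal L (IsCMField.complexConj L) v (![a, b, d] i) * ![a, b, d] i = 1 := by
    intro i; fin_cases i
    · exact ha1
    · exact hb1
    · exact hd1
  have hall := (exists_unitary_conj_iff_forall_exists_norm (conjLocal L (IsCMField.complexConj L) v) _ hHd hγ hP
    (injective_vecThree' hab hbd had) hu1 hg hg').1 ⟨c.val, hmem c, hcval⟩ i
  obtain ⟨z, hz, hzz⟩ := hall
  obtain ⟨z₁, hz₁, hz₁z⟩ := hgi
  refine hg'i ⟨z * z₁, hz.mul hz₁, ?_⟩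
  rw [hzz, hz₁z, map_mul]
  ring

/-- **THE FOUR MATCHED REPRESENTATIVES (the G-side dictionary of the count junction).**  At a finite place `v` of `L⁺` non-split and unramified in `L`, of good
reduction for `H′`, let `γ_H = (g, u) ∈ H_v` have a type-(1) `U(Φ₂)`-part: an eigenframe `g P₂ = P₂ diag(a, d)` over `E_v` with norm-one `a ≠ d`, both `≠ u`
(`u = finGammaTwo`, ★ (E1) `exists_eigenframe_cmDatum_local_of_isRoot_map_of_separable` produces it from a root of `χ_{g,w}`); and let `e, π, π′ ∈ E_v` be
Flicker's scalars (`2e = 1`, `π` `σ`-fixed with `π π′ = 1`; ★ `exists_flicker_scalars_of_nonsplit`).  Then there are `t₁, t₂, t₃, t₄ ∈ G′_v = U(H′)(L⁺_v)`,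
ALL MATCHED WITH `γ_H` (★ `IsLocalNormPair`), with `t₁` of type (1) (eigenframe `P = T̃⁻¹ P₁`, eigenvalues `(a, u, d)`), conjugators `g₂ = diag(π,1,1)`, `g₃`, `g₄` of
the images (`ψ tᵢ = gᵢ (ψ t₁) gᵢ⁻¹`, so `tᵢ = cᵢ t₁ cᵢ⁻¹` with `cᵢ = T̃⁻¹ gᵢ T̃`, `inv_mul_conj_mul_eq`), and images under the level-preserving congruence `ψ : G′_v ≃ₜ* U(Φ₃)(L⁺_v)` (`ψ g = T̃ g T̃⁻¹`,
`ᵗσ(T̃) Φ₃ T̃ = H′ ⊗ 1`, `ψ(K′) = K`) EQUAL TO FLICKER'S LITERALS `t_1(a,u,d)`, `t_π(a,u,d)`, `t_π(a,d,u)`, `t_π(u,a,d)` (★ `UnitFundamentalLemmaInertFlickerTorus`).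
These are the binders `h₁…h₄, hP, hu′, hu′1` of ★ `finsum_delta_mul_classOrbitalIntegral_eq_of_four_classes_of_values`; `h12, h34` are
`not_isConj_of_flicker_representatives` below and the signs follow in the sequel. [cite: Flicker1998UnitaryFL, §2 Prop. 3 pp. 78–79; §3 p. 80]
[cite: Rogawski1990, §3.6 p. 31; §4.3 (4.3.1) p. 43; §14.2 p. 233] -/
theorem exists_four_matched_flicker_representatives (hH' : (H'.map (IsCMField.complexConj L))ᵀ = H')
    (w : PlacesOver L v) (hw : IsCMField.complexConj L • w.1 = w.1) (hv : Algebra.IsUnramifiedIn (𝓞 L) v.asIdeal)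
    (hH'w : IsUnit (placeForm H' w.1)) (hH'i : hH'w.unit ∈ glInt 3 (w.1.adicCompletion L))
    {γH : (cmDatum L 2 (Matrix.of fun i j : Fin 2 => if i.val + j.val + 1 = 2 then (1 : L) else 0)).Local v ×
      (cmDatum L 1 (Matrix.of fun i j : Fin 1 => if i.val + j.val + 1 = 1 then (1 : L) else 0)).Local v}
    {e π π' x y a d : LocalRing L v} (h2 : 2 * e = 1) (hσπ : conjLocal L (IsCMField.complexConj L) v π = π) (hππ : π * π' = 1)
    (hπN : ∀ z : LocalRing L v, conjLocal L (IsCMField.complexConj L) v z * z ≠ π)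
    (hx : conjLocal L (IsCMField.complexConj L) v x * x = 2) (hy : conjLocal L (IsCMField.complexConj L) v y * y = -2)
    (ha1 : conjLocal L (IsCMField.complexConj L) v a * a = 1) (hd1 : conjLocal L (IsCMField.complexConj L) v d * d = 1)
    {P₂ : GL (Fin 2) (LocalRing L v)} (hP₂ : (γH.1.val.val : Matrix (Fin 2) (Fin 2) (LocalRing L v)) * P₂.val = P₂.val * diagonal ![a, d])
    (had : a ≠ d) (hab : a ≠ finGammaTwo L v γH) (hbd : finGammaTwo L v γH ≠ d) :
    ∃ (Tl : GL (Fin 3) (LocalRing L v))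
      (ψ : ↥(UnitaryGroup.«local» L (IsCMField.complexConj L) 3 H' v) ≃ₜ*
        ↥(UnitaryGroup.«local» L (IsCMField.complexConj L) 3 (Matrix.of fun i j : Fin 3 => if i.val + j.val + 1 = 3 then (1 : L) else 0) v))
      (t₁ t₂ t₃ t₄ : (cmDatum L 3 H').Local v)
      (τ₁ τ₂ τ₃ τ₄ : ↥(UnitaryGroup.«local» L (IsCMField.complexConj L) 3 (Matrix.of fun i j : Fin 3 => if i.val + j.val + 1 = 3 then (1 : L) else 0) v))
      (P P₁ dπ g₃ g₄ : GL (Fin 3) (LocalRing L v)),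
      -- the congruence
      formCongr (conjLocal L (IsCMField.complexConj L) v) Tl (Matrix.of fun i j : Fin 3 => if i.val + j.val + 1 = 3 then (1 : LocalRing L v) else 0) =
          (adelicForm L 3 H').map (adeleToLocal L v) ∧
      (∀ g, (ψ g).val = Tl * g.val * Tl⁻¹) ∧ (∀ g, (ψ.symm g).val = Tl⁻¹ * g.val * Tl) ∧
      (∀ g, g ∈ cmLocalIntegralLevel L 3 H' v ↔
        ψ g ∈ cmLocalIntegralLevel L 3 (Matrix.of fun i j : Fin 3 => if i.val + j.val + 1 = 3 then (1 : L) else 0) v) ∧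
      -- matching
      IsLocalNormPair L H' v γH t₁ ∧ IsLocalNormPair L H' v γH t₂ ∧ IsLocalNormPair L H' v γH t₃ ∧ IsLocalNormPair L H' v γH t₄ ∧
      -- the type-(1) frame of `t₁`
      (t₁.val.val : Matrix (Fin 3) (Fin 3) (LocalRing L v)) * P.val = P.val * diagonal ![a, finGammaTwo L v γH, d] ∧
      Function.Injective ![a, finGammaTwo L v γH, d] ∧
      (∀ i, conjLocal L (IsCMField.complexConj L) v (![a, finGammaTwo L v γH, d] i) * ![a, finGammaTwo L v γH, d] i = 1) ∧
      P = Tl⁻¹ * P₁ ∧ P₁.val = !![1, 0, 1; 0, 1, 0; -1, 0, 1] ∧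
      -- the images under `ψ`: Flicker's literals and their conjugators
      ψ t₁ = τ₁ ∧ ψ t₂ = τ₂ ∧ ψ t₃ = τ₃ ∧ ψ t₄ = τ₄ ∧
      τ₁.val.val = !![e * (a + d), 0, -(e * (a - d)); 0, finGammaTwo L v γH, 0; -(e * (a - d)), 0, e * (a + d)] ∧
      τ₂.val = dπ * τ₁.val * dπ⁻¹ ∧ τ₃.val = g₃ * τ₁.val * g₃⁻¹ ∧ τ₄.val = g₄ * τ₁.val * g₄⁻¹ ∧
      dπ.val = !![π, 0, 0; 0, 1, 0; 0, 0, 1] ∧ g₃.val = !![e * π, π, -(e * π); e, 0, e; -e, 1, e] ∧ g₄.val = !![e * π, π, e * π; e, 0, -e; e, -1, e] ∧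
      τ₂.val.val = !![e * (a + d), 0, -(e * (a - d) * π); 0, finGammaTwo L v γH, 0; -(e * (a - d) * π'), 0, e * (a + d)] ∧
      τ₃.val.val =
        !![e * (a + finGammaTwo L v γH), 0, -(e * (a - finGammaTwo L v γH) * π); 0, d, 0; -(e * (a - finGammaTwo L v γH) * π'), 0, e * (a + finGammaTwo L v γH)] ∧
      τ₄.val.val =
        !![e * (finGammaTwo L v γH + d), 0, -(e * (finGammaTwo L v γH - d) * π); 0, a, 0; -(e * (finGammaTwo L v γH - d) * π'), 0, e * (finGammaTwo L v γH + d)] ∧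
      -- non-conjugacy (`h12`, `h34`)
      ¬ IsConj t₁ t₂ ∧ ¬ IsConj t₃ t₄ := by
  classical
  obtain ⟨αg, hα0, hcα, -⟩ := cmQuadraticGenerator_spec L
  letI : Field (LocalRing L v) :=
    (Liu2021.LemD1IndexedNonVacuityNonsplitPlace.isField_localRing_of_nonsplit L v (IsCMField.complexConj L) hcα hα0 w hw).toField
  have hb1 := conjLocal_finGammaTwo_mul_finGammaTwo L v γH
  -- §2 the congruence, §3 the literals
  obtain ⟨Tl, ψ, hform, hψ, hψs, hlev⟩ := exists_localRing_congr L H' hH' w hw hv hH'w hH'i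
  obtain ⟨τ₁, τπ, τ₃, τ₄, P₁, dπ, g₃, g₄, hτ₁, hτπ, hτ₃, hτ₄, hP₁, hdπ, hg₃, hg₄, hvπ, hv₃, hv₄⟩ :=
    exists_flicker_literals_mem_local L w hw (a := a) (b := finGammaTwo L v γH) (d := d) h2 hσπ hππ ha1 hb1 hd1
  -- eigenframes
  have hau : IsUnit a := IsUnit.of_mul_eq_one_right _ ha1
  have hdu : IsUnit d := IsUnit.of_mul_eq_one_right _ hd1
  have hdDa : Matrix.det (diagonal ![a, d]) ≠ 0 := by
    rw [det_diagonal, Fin.prod_univ_two]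
    exact mul_ne_zero hau.ne_zero hdu.ne_zero
  have hXframe := endoEmbLocal_mul_endoGL_frame L (γH := γH) (P₂ := P₂) (Da := Matrix.GeneralLinearGroup.mkOfDetNeZero _ hdDa) rfl hP₂
  have hτframe : τ₁.val.val * P₁.val = P₁.val * diagonal ![a, finGammaTwo L v γH, d] := by
    rw [hτ₁, hP₁, flickerTorusElt_one_mul_frame h2, etaDiag_eq_diagonal]
  have h1τ₁ : τ₁.val = 1 * τ₁.val * 1⁻¹ := by rw [one_mul, inv_one, mul_one]
  -- non-conjugacy in `U(Φ₃)(L⁺_v)` from one norm test each (★ FILE 3), pulled back along `ψ`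
  have h20 : (2 : LocalRing L v) ≠ 0 := fun h0 => by
    have h1 := h2; rw [h0, zero_mul] at h1; exact zero_ne_one h1
  have n12 : ¬ IsConj τ₁ τπ :=
    not_isConj_of_normTest L w hw ha1 hb1 hd1 hab hbd had hτframe h1τ₁ hτπ 0
      ((normTest_one_conj_iff (conjLocal L (IsCMField.complexConj L) v) P₁ 0).2 rfl)
      (fun h => absurd ((normTest_diag_conj_iff (conjLocal L (IsCMField.complexConj L) v) hσπ hπN h20 hP₁ hdπ 0).1 h) (by decide))
  have n43 : ¬ IsConj τ₄ τ₃ :=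
    not_isConj_of_normTest L w hw ha1 hb1 hd1 hab hbd had hτframe hτ₄ hτ₃ 0
      ((normTest_gFour_conj_iff (conjLocal L (IsCMField.complexConj L) v) h2 hσπ hπN hy h20 hP₁ hg₄ 0).2 rfl)
      (fun h => absurd ((normTest_gThree_conj_iff (conjLocal L (IsCMField.complexConj L) v) h2 hσπ hπN hx h20 hP₁ hg₃ 0).1 h) (by decide))
  have pull : ∀ {σ₁ σ₂ : ↥(UnitaryGroup.«local» L (IsCMField.complexConj L) 3 (Matrix.of fun i j : Fin 3 => if i.val + j.val + 1 = 3 then (1 : L) else 0) v)},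
      ¬ IsConj σ₁ σ₂ → ¬ IsConj (ψ.symm σ₁) (ψ.symm σ₂) := by
    intro σ₁ σ₂ hn hc
    have h : IsConj (ψ (ψ.symm σ₁)) (ψ (ψ.symm σ₂)) := MonoidHom.map_isConj ψ.toMulEquiv.toMonoidHom hc
    rw [ContinuousMulEquiv.apply_symm_apply, ContinuousMulEquiv.apply_symm_apply] at h
    exact hn h
  -- the representatives
  refine ⟨Tl, ψ, ψ.symm τ₁, ψ.symm τπ, ψ.symm τ₃, ψ.symm τ₄, τ₁, τπ, τ₃, τ₄, Tl⁻¹ * P₁, P₁, dπ, g₃, g₄,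
    hform, hψ, hψs, hlev,
    isLocalNormPair_symm_of_frames L H' ψ hψs hXframe hτframe h1τ₁, isLocalNormPair_symm_of_frames L H' ψ hψs hXframe hτframe hτπ,
    isLocalNormPair_symm_of_frames L H' ψ hψs hXframe hτframe hτ₃, isLocalNormPair_symm_of_frames L H' ψ hψs hXframe hτframe hτ₄,
    ?_, injective_vecThree' hab hbd had, ?_, rfl, hP₁,
    ψ.apply_symm_apply τ₁, ψ.apply_symm_apply τπ, ψ.apply_symm_apply τ₃, ψ.apply_symm_apply τ₄,
    hτ₁, hτπ, hτ₃, hτ₄, hdπ, hg₃, hg₄, hvπ, hv₃, hv₄,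
    pull n12, pull (fun h => n43 h.symm)⟩
  · -- frame of `t₁ = Tl⁻¹ τ₁ Tl`
    have h := conj_mul_frame_eq (g := Tl⁻¹) hτframe
    rw [inv_inv] at h
    rw [hψs τ₁, Units.val_mul]
    exact h
  · intro i
    fin_cases i
    · exact ha1
    · exact hb1
    · exact hd1

end Representatives

end Literature.NumberTheory.Rogawski1990
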